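import Literature.Computability.AlgebraicComplexity.IK2020Thm42Glue
import Literature.Computability.AlgebraicComplexity.IK2020Thm42LiftIdentity
import Literature.Computability.AlgebraicComplexity.IK2020TableauLiftingOdd
import Literature.Computability.AlgebraicComplexity.IK2020LiftedTableauPolynomial
import Literature.Computability.AlgebraicComplexity.IK2020OrbitFunctionsFact
import Literature.Computability.AlgebraicComplexity.IK2020Cor45PlethysmPositivity
import Literature.RepresentationTheory.FiniteGroups.SymmetricGroupFrobeniusFormula
import HarnessLib

/-!
# Ikenmeyer–Kandasamy 2020, Thm. 4.2 from the orbit functions: the assembly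

Topic `Literature/Computability/AlgebraicComplexity` (val-lit cell, programme "IK20 #2", lead-bip
rulings 2026-08-27T01:54Z / 02:09Z). Theorems only: no definition, no named fact, no instance.

IK 2020 Thm. 4.2 (tree fact `IK2020_thm_4_2`, `IK20HighestWeightVectors.lean`) is proved in print
(§13, TeX L1146–1210) from: (I1) the Tableau Lifting Theorem 13.1 (tree `IK2020_thm_13_1_holds`);
(I3) the §13 identity on `SL_m` between the tableau function of the lifted tableau and the orbit
function of `S` (tree: p4's `IK2020.stab_card_mul_sum_gammaProd_lift_eq`,
`IK2020Thm42LiftIdentity.lean`); (I4) the tableau polynomial of the lift as a highest-weight vector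
of `ℂ[Sym^D ℂ^m]` (tree: t08's `IK2020.exists_hwv_liftedTableau_revScale`,
`IK2020LiftedTableauPolynomial.lean`); (I5) BI's fundamental invariant `Φ` (tree:
`IK2020.exists_slInvariant_hwv_aeval_psum_const`, `IK2020Thm42Glue.lean`); (I7) the evaluation
rank bound (tree: `IK2020.le_orbitMultiplicity_of_linearIndependent_sl`); and (I8) the linearly
independent orbit functions `g ↦ γ(g P_m S_{ϱ,i})` of §9–§10 — the cite-fact
`IK2020_thm_9_1_orbitFunctions` (unit t08). This file assembles them.

* `IK2020.exists_hwv_of_lift_data` — steps L1177–1206 for ONE tableau `S`: from the lift `(L, R)`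
  (properties (1)–(3) of Thm. 13.1), a highest-weight vector `P` of weight `(λ + m × eD)^*` whose
  values on `SL_m · p` are `κ Σ_φ γ(g, φL) γ(g, φR)`, and `e ≤ e_Ξ`: a highest-weight vector `F` of
  weight `(λ + m × e_Ξ D)^*` whose values on `SL_m · p` are a NON-ZERO constant multiple of the orbit
  function `g ↦ Σ_{π ∈ 𝔖_m} γ(g, πS)`.
* `IK2020.le_orbitMultiplicity_of_scaled_orbitFunctions` — steps L1207–1210: highest-weight vectors
  whose values on `SL_m · p` are non-zero multiples of linearly independent functions on `SL_m`
  number at most `mult`.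
* `IK2020_thm_4_2_of_orbitFunctions : IK2020_thm_9_1_orbitFunctions → IK2020_thm_4_2` — the EDGE.

Honest framing: bookkeeping of IK's toy model `p = x₁^D + ⋯ + x_m^D`, an EDGE to one Peter–Weyl
cite-fact; VP ≠ VNP is NOT proved and nothing here is progress on it.

## References
* [IkenmeyerKandasamy2019] C. Ikenmeyer, U. Kandasamy, arXiv:1911.03990, Thm. 4.2 and §13 (its
  proof), TeX L1119–1210.
-/

noncomputable section

open MvPolynomial
open scoped BigOperators

namespace Literature.Computability.AlgebraicComplexity

open _root_.Literature.NumberTheory.DiophantineGeometry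

namespace IK2020

/-! ## Parities and the bound `e_ϱ ≤ e_Ξ` -/

/-- For odd `D`, `e_ϱ = ∑ 2⌈ϱ_i/(2(D-2))⌉` is even (Thm. 4.2, TeX L396–397).
[cite: IkenmeyerKandasamy2019, Thm. 4.2] -/
theorem even_eRho_of_odd {D : ℕ} (hD : Odd D) (s : Multiset ℕ) : Even (eRho D s) := by
  unfold eRho
  rw [if_neg (Nat.not_even_iff_odd.mpr hD)]
  induction s using Multiset.induction_on with
  | empty => simp
  | cons a t ih =>
    rw [Multiset.map_cons, Multiset.sum_cons]
    exact (even_two_mul _).add ih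

/-- For odd `D`, `e_Ξ = max e_ϱ` is even (Thm. 4.2, TeX L396–399; `e_∅ = 0`).
[cite: IkenmeyerKandasamy2019, Thm. 4.2] -/
theorem even_eXi_of_odd {D d : ℕ} (hD : Odd D) (Ξ : Finset (Nat.Partition d)) : Even (eXi D Ξ) := by
  classical
  unfold eXi
  induction Ξ using Finset.induction_on with
  | empty => simp
  | insert a s ha ih =>
    rw [Finset.sup_insert]
    rcases le_total (eRho D a.parts) (s.sup fun ρ => eRho D ρ.parts) with h | h
    · rw [sup_eq_right.mpr h]; exact ih
    · rw [sup_eq_left.mpr h]; exact even_eRho_of_odd hD _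

/-- `e_ϱ ≤ e_Ξ` for `ϱ ∈ Ξ` (Thm. 4.2, TeX L398–399: "`e_Ξ := max{e_ϱ | ϱ ∈ Ξ}`").
[cite: IkenmeyerKandasamy2019, Thm. 4.2] -/
theorem eRho_le_eXi {D d : ℕ} {Ξ : Finset (Nat.Partition d)} {ρ : Nat.Partition d} (hρ : ρ ∈ Ξ) :
    eRho D ρ.parts ≤ eXi D Ξ :=
  Finset.le_sup (f := fun ρ : Nat.Partition d => eRho D ρ.parts) hρ

/-- `e_ϱ` does not see zero parts: padding `ϱ` to `m` entries does not change it
(`IK2020.eRho`'s docstring; Thm. 13.1 versus Thm. 4.2). [cite: IkenmeyerKandasamy2019, Thm. 4.2] -/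
theorem eRho_add_replicate_zero (D : ℕ) (s : Multiset ℕ) (n : ℕ) :
    eRho D (s + Multiset.replicate n 0) = eRho D s := by
  rw [eRho_eq_sum_blockCount, eRho_eq_sum_blockCount, Multiset.map_add, Multiset.sum_add,
    Multiset.map_replicate, blockCount_zero, Multiset.sum_replicate, smul_zero, add_zero]

/-- `e_ϱ` of the padded row vector `(ϱ_1, …, ϱ_ℓ, 0, …, 0) ∈ ℕ^m` of a partition `ϱ ⊢_m d`
(the content datum of `IK2020_thm_9_1_orbitFunctions` / Thm. 13.1) is `e_ϱ` of `ϱ`'s parts (the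
datum of `eXi`, Thm. 4.2). [cite: IkenmeyerKandasamy2019, Thm. 4.2] -/
theorem eRho_univ_map_getD {d m : ℕ} (D : ℕ) (ρ : Nat.Partition d) (hρ : ρ.parts.card ≤ m) :
    eRho D (Finset.univ.val.map fun a : Fin m => ρ.sortedParts.getD a 0) = eRho D ρ.parts := by
  have hlen : ρ.sortedParts.length ≤ m := by rw [Nat.Partition.length_sortedParts]; exact hρ
  have hl : (List.ofFn fun a : Fin m => ρ.sortedParts.getD a 0) =
      ρ.sortedParts ++ List.replicate (m - ρ.sortedParts.length) 0 := by
    apply List.ext_getElem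
    · rw [List.length_ofFn, List.length_append, List.length_replicate]
      omega
    · intro i h1 h2
      rw [List.getElem_ofFn]
      by_cases hi : i < ρ.sortedParts.length
      · rw [List.getElem_append_left hi, List.getD_eq_getElem _ _ hi]
      · rw [List.getElem_append_right (not_lt.mp hi), List.getElem_replicate,
          List.getD_eq_default _ _ (not_lt.mp hi)]
  have hcoe : (ρ.sortedParts : Multiset ℕ) = ρ.parts := Multiset.sort_eq _ _
  rw [Fin.univ_val_map, hl, ← Multiset.coe_add, Multiset.coe_replicate, eRho_add_replicate_zero,
    hcoe]

/-! ## One tableau: the lifted highest-weight vector times a power of `Φ` (TeX L1177–1206) -/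

section OneTableau

open scoped Classical

/-- **IK 2020 §13, TeX L1177–1206, for one tableau `S`.** Data: the lift `(L, R)` of `S` with
properties (1)–(2) (`h12`) and (3) (`h3`) of the Tableau Lifting Theorem; a highest-weight vector
`P` of `ℂ[Sym^D ℂ^m]` of weight `λ^* - eD·𝟙 = (λ + m × eD)^*` whose value at `A · p`
(`p = x₁^D + ⋯ + x_m^D`, `s ∈ SL_m`) is `κ · Σ_φ γ(β s, φL) γ(β s, φR)` with `κ ≠ 0` for some
self-map `β` of `SL_m` (the tableau polynomial of the lift, Thm. 11.1 — t08's brick B2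
`exists_hwv_liftedTableau_revScale`, where `β s = ζ⁻¹ · (s with rows reversed)` absorbs the
tree's highest-weight convention); numbers `e ≤ e_X` with `e_X - e` even when `D` is
odd. Conclusion: a highest-weight vector `F = Φ^{…} · P` of weight `λ^* - e_X D·𝟙` whose values on
`SL_m · p` are `κ' · Σ_{π ∈ 𝔖_m} γ(g, πS)` with `κ' ≠ 0` ("`f̄^{S}` coincides with `f^{S}` when
restricted to `SL_m p` up to a nonzero factor", L1205–1206; here `f^{S} ∘ β`, and the factor is
`Φ(p)^{…} κ N / #Stab(S)` by p4's `stab_card_mul_sum_gammaProd_lift_eq` at `β s`).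
[cite: IkenmeyerKandasamy2019, §13 (proof of Thm. 4.2), TeX L1177–1206] -/
theorem exists_hwv_of_lift_data {m D : ℕ} (hD : 3 ≤ D) (hDm : D ≤ m)
    (hodd : Odd D → 2 * (m - 1) ≤ Nat.choose (2 * (D - 1)) (D - 1))
    {n : ℕ} (lam : Nat.Partition n) {e eX : ℕ} (he : e ≤ eX) (hpar : Odd D → Even (eX - e))
    (S : ColTableau (Fin m)) (hS : ∀ c, S.h c ≤ m) {E δ : ℕ}
    (L : Fin E → Fin m → Fin δ) (R : (c : Fin S.C) → Fin (S.h c) → Fin δ)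
    (h12 : ∀ φ : Fin δ → Fin m, (rectTableau fun c r => φ (L c r)).IsRegular →
      ((ColTableau.mk S.C S.h R).relabel φ).IsRegular →
        (∃ π : Equiv.Perm (Fin m), (ColTableau.mk S.C S.h R).relabel φ = S.relabel π) ∧
        (rectTableau fun c r => φ (L c r)).IsDuplex)
    (h3 : ∃ φ : Fin δ → Fin m, (rectTableau fun c r => φ (L c r)).IsRegular ∧
      ((ColTableau.mk S.C S.h R).relabel φ).IsRegular ∧ (ColTableau.mk S.C S.h R).relabel φ = S)
    (P : MvPolynomial (DegIdx (Fin m) D) ℂ) {κ : ℂ} (hκ : κ ≠ 0)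
    (hP : P ∈ highestWeightSpace (coordRep (Fin m) ℂ D)
      (fun i => Weight.dualOfPartition m lam i - ((e * D : ℕ) : ℤ)))
    (β : Matrix.SpecialLinearGroup (Fin m) ℂ → Matrix.SpecialLinearGroup (Fin m) ℂ)
    (hPev : ∀ s : Matrix.SpecialLinearGroup (Fin m) ℂ,
      aeval (formCoeff D (linSubst (Fin m) ℂ (s : Matrix (Fin m) (Fin m) ℂ)
        (MvPolynomial.psum (Fin m) ℂ D))) P =
        κ * ∑ φ : Fin δ → Fin m,
          gammaProd ℂ ((β s : Matrix.SpecialLinearGroup (Fin m) ℂ) : Matrix (Fin m) (Fin m) ℂ)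
              (fun _ : Fin E => m) (fun _ => le_rfl) (fun c r => φ (L c r)) *
            gammaProd ℂ ((β s : Matrix.SpecialLinearGroup (Fin m) ℂ) : Matrix (Fin m) (Fin m) ℂ)
              S.h hS (fun c r => φ (R c r))) :
    ∃ F : MvPolynomial (DegIdx (Fin m) D) ℂ,
      F ∈ highestWeightSpace (coordRep (Fin m) ℂ D)
          (fun i => Weight.dualOfPartition m lam i - ((eX * D : ℕ) : ℤ)) ∧
      ∃ κ' : ℂ, κ' ≠ 0 ∧ ∀ s : Matrix.SpecialLinearGroup (Fin m) ℂ,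
        aeval (formCoeff D (linSubst (Fin m) ℂ (s : Matrix (Fin m) (Fin m) ℂ)
          (MvPolynomial.psum (Fin m) ℂ D))) F =
          κ' * ∑ π : Equiv.Perm (Fin m),
            gammaProd ℂ ((β s : Matrix.SpecialLinearGroup (Fin m) ℂ) : Matrix (Fin m) (Fin m) ℂ)
              S.h hS (fun c r => π (S.entry c r)) := by
  -- the power of the fundamental invariant, of weight `-(e_X - e)D·𝟙`, constant `c ≠ 0` on `SL_m·p`
  obtain ⟨Ψ, hΨ, c, hc, hΨev⟩ :=
    exists_slInvariant_hwv_aeval_psum_const hD hDm hodd (eX - e) hpar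
  -- the two counts of the lift identity
  have hst := card_filter_stab_pos S
  have hN := card_filter_lift_preimage_pos S L R h3
  refine ⟨Ψ * P, ?_, ?_⟩
  · have hw := mul_mem_highestWeightSpace_coordRep hΨ hP
    have heq : ((fun _ : Fin m => -(((eX - e) * D : ℕ) : ℤ)) +
        fun i => Weight.dualOfPartition m lam i - ((e * D : ℕ) : ℤ)) =
        fun i => Weight.dualOfPartition m lam i - ((eX * D : ℕ) : ℤ) := by
      funext i
      simp only [Pi.add_apply, Nat.cast_mul, Nat.cast_sub he]
      ring
    rw [heq] at hw
    exact hw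
  · -- the scalar: `c κ N / #Stab(S)`
    set A : ℂ := ((Finset.univ.filter fun π : Equiv.Perm (Fin m) => S.relabel π = S).card : ℂ)
      with hA
    set B : ℂ := ((Finset.univ.filter fun φ : Fin δ → Fin m =>
        (rectTableau fun c r => φ (L c r)).IsRegular ∧
          ((ColTableau.mk S.C S.h R).relabel φ).IsRegular ∧
          (ColTableau.mk S.C S.h R).relabel φ = S).card : ℂ) with hB
    have hA0 : A ≠ 0 := Nat.cast_ne_zero.mpr hst.ne'
    have hB0 : B ≠ 0 := Nat.cast_ne_zero.mpr hN.ne'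
    refine ⟨c * κ * (A⁻¹ * B), mul_ne_zero (mul_ne_zero hc hκ)
      (mul_ne_zero (inv_ne_zero hA0) hB0), fun s => ?_⟩
    have hs : (s : Matrix (Fin m) (Fin m) ℂ).det = 1 := s.prop
    have hβs : ((β s : Matrix.SpecialLinearGroup (Fin m) ℂ) : Matrix (Fin m) (Fin m) ℂ).det = 1 :=
      (β s).prop
    have hB1 := stab_card_mul_sum_gammaProd_lift_eq (k := ℂ)
      ((β s : Matrix.SpecialLinearGroup (Fin m) ℂ) : Matrix (Fin m) (Fin m) ℂ) hβs S hS L R h12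
    rw [← hA, ← hB] at hB1
    have key : ∀ {X Y : ℂ}, A * X = B * Y → X = A⁻¹ * B * Y := by
      intro X Y h
      have h' : A⁻¹ * (A * X) = A⁻¹ * (B * Y) := by rw [h]
      rw [← mul_assoc, inv_mul_cancel₀ hA0, one_mul, ← mul_assoc] at h'
      exact h'
    rw [map_mul, hΨev _ hs, hPev s, key hB1]
    ring

end OneTableau

/-! ## The count (TeX L1207–1210) -/

/-- **IK 2020 §13, TeX L1207–1210**: "Since each `f̄^{S_{ϱ,i}}` coincides with `f^{S_{ϱ,i}}`
when restricted to `SL_m p` (up to a nonzero factor), the `f̄^{S_{ϱ,i}}` are linearly independent.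
It follows … [`mult_{ν^*} ℂ[\overline{Gp}] ≥` their number]." Highest-weight vectors `F_j` of
weight `χ` whose values on `SL_m · f` are non-zero multiples `κ_j f_j` of linearly independent
functions `f_j : SL_m(ℂ) → ℂ` number at most `orbitMultiplicity ℂ f D χ`.
[cite: IkenmeyerKandasamy2019, §13 (proof of Thm. 4.2), TeX L1207–1210] -/
theorem le_orbitMultiplicity_of_scaled_orbitFunctions {m D : ℕ} (hD : D ≠ 0) {χ : Weight (Fin m)}
    {ι : Type*} [Fintype ι] (f : ι → Matrix.SpecialLinearGroup (Fin m) ℂ → ℂ)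
    (hli : LinearIndependent ℂ f) (F : ι → MvPolynomial (DegIdx (Fin m) D) ℂ)
    (hF : ∀ j, F j ∈ highestWeightSpace (coordRep (Fin m) ℂ D) χ) (q : MvPolynomial (Fin m) ℂ)
    (κ : ι → ℂ) (hκ : ∀ j, κ j ≠ 0)
    (hFf : ∀ j (s : Matrix.SpecialLinearGroup (Fin m) ℂ),
      aeval (formCoeff D (linSubst (Fin m) ℂ (s : Matrix (Fin m) (Fin m) ℂ) q)) (F j) = κ j * f j s) :
    Fintype.card ι ≤ orbitMultiplicity ℂ q D χ := by
  refine le_orbitMultiplicity_of_linearIndependent_sl hD F hF q ?_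
  have hfun : (fun j (s : Matrix.SpecialLinearGroup (Fin m) ℂ) =>
      aeval (formCoeff D (linSubst (Fin m) ℂ (s : Matrix (Fin m) (Fin m) ℂ) q)) (F j)) =
      (fun j => Units.mk0 (κ j) (hκ j)) • f := by
    funext j s
    rw [hFf, Pi.smul_apply', Pi.smul_apply, Units.smul_mk0, smul_eq_mul]
  rw [hfun]
  exact hli.units_smul _

/-! ## The assembly -/

end IK2020

open IK2020 in
/-- **Ikenmeyer–Kandasamy 2020, Thm. 4.2 (Main Technical Theorem) from the orbit functions** —
the named fact `IK2020_thm_4_2` follows from the cite-fact `IK2020_thm_9_1_orbitFunctions` (Thm. 9.1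
∘ Prop. 10.1: the linearly independent orbit functions `g ↦ γ(g P_m S_{ϱ,i})`, t08) by the
printed proof of §13 (TeX L1146–1210), all of whose other inputs are theorems of the tree: the
Tableau Lifting Theorem `IK2020_thm_13_1_holds` (t08), the lift identity
`IK2020.stab_card_mul_sum_gammaProd_lift_eq` (p4), the tableau polynomial of the lift
`IK2020.exists_hwv_liftedTableau_revScale` with `exists_root_sign_rev` / `exists_slEquiv_revScale`
(t08), the fundamental invariant `IK2020.exists_slInvariant_hwv_aeval_psum_const` and the count
`IK2020.le_orbitMultiplicity_of_linearIndependent_sl` (t02). Wiring: per index `(ϱ, i)` of the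
cite-fact's family — padded content `a ↦ ϱ_a`, 13.1 ⇒ `(L, R)`, B2 ⇒ `P` (values through
`β = ζ⁻¹ · row reversal` on `SL_m`), `exists_hwv_of_lift_data` (`e_ϱ ≤ e_Ξ`, parities) ⇒ `F_{ϱ,i}`
of weight `(λ + (m × e_Ξ D))^*` (`dualOfPartition_addRect`) with `F_{ϱ,i}(s · p) = κ'·f^{S_{ϱ,i}}(β s)`;
independence of `f^{S} ∘ β` (`linearIndependent_comp_right_of_surjective`); then
`le_orbitMultiplicity_of_scaled_orbitFunctions` and `card (Σ ϱ : Ξ, Fin b) = Σ_{ϱ ∈ Ξ} b`. An EDGE: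
`IK2020_thm_4_2` ⇐ {`IK2020_thm_9_1_orbitFunctions`} by theorem; VP ≠ VNP is NOT proved.
[cite: IkenmeyerKandasamy2019, Thm. 4.2 with §13 (its proof), TeX L1146–1210] -/
theorem IK2020_thm_4_2_of_orbitFunctions (hG : IK2020_thm_9_1_orbitFunctions) : IK2020_thm_4_2 := by
  intro m d D hD hDm hodd lam hlam Ξ hΞ
  classical
  have hm0 : 0 < m := by omega
  -- the row-reversal twist of B2
  obtain ⟨ζ, hζ⟩ := exists_root_sign_rev hm0
  have hζ0 : ζ ≠ 0 := by
    intro h0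
    have h1 : ((Equiv.Perm.sign (@Fin.revPerm m) : ℤ) : ℂ) ≠ 0 :=
      Int.cast_ne_zero.mpr (Units.ne_zero _)
    exact h1 (by rw [← hζ, h0, zero_pow hm0.ne'])
  obtain ⟨β, hβ⟩ := exists_slEquiv_revScale hm0 ζ hζ
  -- the orbit functions
  obtain ⟨S, hS, hprop, hli⟩ := hG m D d hD hDm lam hlam Ξ hΞ
  have hli' := linearIndependent_comp_right_of_surjective hli β β.surjective
  -- per index: the highest-weight vector of weight `(λ + (m × e_Ξ D))^*`
  have hper : ∀ j : (Σ ρ : Ξ, Fin (bCoeff ℂ m D d lam ρ)),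
      ∃ F : MvPolynomial (DegIdx (Fin m) D) ℂ,
        F ∈ highestWeightSpace (coordRep (Fin m) ℂ D)
            (fun i => Weight.dualOfPartition m lam i - ((eXi D Ξ * D : ℕ) : ℤ)) ∧
        ∃ κ' : ℂ, κ' ≠ 0 ∧ ∀ s : Matrix.SpecialLinearGroup (Fin m) ℂ,
          aeval (formCoeff D (linSubst (Fin m) ℂ (s : Matrix (Fin m) (Fin m) ℂ)
            (MvPolynomial.psum (Fin m) ℂ D))) F =
            κ' * ∑ π : Equiv.Perm (Fin m),
              gammaProd ℂ ((β s : Matrix.SpecialLinearGroup (Fin m) ℂ) : Matrix (Fin m) (Fin m) ℂ)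
                (S j.1 j.2).h (hS j.1 j.2) (fun c r => π ((S j.1 j.2).entry c r)) := by
    rintro ⟨ρ, i⟩
    obtain ⟨hshape, hreg, hrows, hcont⟩ := hprop ρ i
    have hρm : (ρ : Nat.Partition d).parts.card ≤ m := hΞ ρ ρ.2
    -- the padded content vector and the Tableau Lifting Theorem
    have hanti : Antitone fun a : Fin m => (ρ : Nat.Partition d).sortedParts.getD a 0 :=
      Literature.RepresentationTheory.FiniteGroups.getD_sortedParts_antitone _
    have hsum : ∑ a : Fin m, (ρ : Nat.Partition d).sortedParts.getD a 0 = d :=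
      Literature.RepresentationTheory.FiniteGroups.sum_getD_sortedParts _ hρm
    obtain ⟨L, R, hcount, h12, h3⟩ := IK2020_thm_13_1_holds D m d hD (by omega) hodd (S ρ i)
      hshape hreg (fun a => (ρ : Nat.Partition d).sortedParts.getD a 0) hanti hsum hcont
    -- the tableau polynomial of the lift (B2), through the twist `β`
    obtain ⟨P, hP, κ, hκ, hPev⟩ := exists_hwv_liftedTableau_revScale hm0 ζ hζ0 lam hlam (S ρ i)
      (hS ρ i) hrows L R hcount
    rw [dualOfPartition_addRect] at hP
    -- `e_ϱ ≤ e_Ξ` and parity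
    have he : eRho D (Finset.univ.val.map fun a : Fin m =>
        (ρ : Nat.Partition d).sortedParts.getD a 0) ≤ eXi D Ξ := by
      rw [eRho_univ_map_getD D _ hρm]
      exact eRho_le_eXi ρ.2
    have hpar : Odd D → Even (eXi D Ξ - eRho D (Finset.univ.val.map fun a : Fin m =>
        (ρ : Nat.Partition d).sortedParts.getD a 0)) := fun hDo =>
      (Nat.even_sub he).mpr (iff_of_true (even_eXi_of_odd hDo Ξ) (even_eRho_of_odd hDo _))
    refine exists_hwv_of_lift_data hD hDm hodd lam he hpar (S ρ i) (hS ρ i) L R h12 h3 P hκ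
      (by simpa only [Nat.cast_mul] using hP) β fun s => ?_
    rw [hβ s]
    exact hPev _
  choose F hF κ hκ hFf using hper
  have hmain := le_orbitMultiplicity_of_scaled_orbitFunctions (by omega : D ≠ 0) _ hli' F hF
    (MvPolynomial.psum (Fin m) ℂ D) κ hκ hFf
  rw [Fintype.card_sigma] at hmain
  simp only [Fintype.card_fin] at hmain
  rw [Finset.sum_coe_sort Ξ (fun ρ => bCoeff ℂ m D d lam ρ)] at hmain
  rw [dualOfPartition_addRect]
  exact hmain

end Literature.Computability.AlgebraicComplexity

end
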